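import Mathlib
import HarnessLib.Audit
import Summits.PneNP.PneNP.Theorems.PstarGateCasePUnitsTouch
import Summits.PneNP.PneNP.Theorems.PstarGateCasePUnitsLocal
import Summits.PneNP.PneNP.Theorems.PstarGateBudget
import Summits.PneNP.PneNP.Theorems.PstarGateBudgetCrosses

/-!
# One GATED chord, CASE P with ONE other chord: the pinned first form, the far-private kill, and the two budgets (E2 node N2X; prover-1 g21)

FRONTIER range-avoidance ladder, rung F-N3 (`stmt-PneNP-19007`), cell `pnp-ideate` (`PstarGateNodesX.GateCasePUnitsX`); restricted-model proof
complexity — nothing here bears on `P` versus `NP`.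

Common part of the (EQ) and the EXC-unit branches of node N2X: one-gate data (`GateDataX`), CASE P (`ReadAlong (1,0)`), exactly one other chord
`e'` (`N − e = {e'}`).  Notation `q = q_{(1,0)}`, `ℓ = coef = κ₀ + x_u`, `σ₀` = the read constant of `e'`.

* `N_eq_pair` — `N = {e, e'}`, `e' ≠ e`, `#N = 2`;
* `caseP_P3` — **the first constraint's form is pinned on `Z(q)`: `q_{(0,1)} + ℓ + σ₀ + 1 ≡ 0`** there (`caseP_fst`; `e'` is ON on `Z(q)` by
  `caseP_forced`, and the gated chord contributes exactly `ℓ`); `coef_add`, `coef_shift`, `qt_add` — `ℓ` is affine and `e_v`-invariant for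
  `v ≠ u`, so `q̃ := q_{(0,1)} + ℓ + c` has polar form `polarDir (0,1)`;
* `false_of_private_far` — **a tree edge private within `J₀ ∪ {g₀}` whose AND variables avoid a family `D'` with `Z(q) ⊆ {Q_{D'} = c}` and are
  invisible to the polar form of `q` does not exist** (rank `q ≥ 4`): `q` and `q_{(0,1)} + ℓ` are invariant under its two AND flips
  (`PstarGateCasePUnitsLocal`), so neither constraint reads them (`PstarGateCasePUnitsTouch` criteria) — against the touch lemma;
* `false_of_private_pair` — nor is an edge of a CONS-T pair `{j₁, j₂}` private once a gadget on its literals belongs to the counted family;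
* `card_le_three_of_no_private`, `card_le_four_of_cross` — the budgets (`gate_budget`, `gate_budget_crosses` with one cross gate) when no
  tree edge is private: `#J₀ ≤ 3`, resp. `#J₀ ≤ 4`.
-/

set_option linter.dupNamespace false -- `Summit.PneNP.PneNP.…`: summit = sub-problem name (D-0017 single-conjunct layout)

open Finset Module Literature.Computability.Complexity
open Summit.PneNP.PneNP.Theorems.PstarFibrePolys (bit)
open Summit.PneNP.PneNP.Theorems.PstarTyped (Typed)
open Summit.PneNP.PneNP.Theorems.PstarSALevel (varSet BoundaryExpanding SimpleOverlap)
open Summit.PneNP.PneNP.Theorems.PstarGapLinearised (andPair andPair_subset_varSet)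
open Summit.PneNP.PneNP.Theorems.PstarChordEndgameTools (mem_andPair_iff)
open Summit.PneNP.PneNP.Theorems.PstarCentreFree (vars_mem_varSet)
open Summit.PneNP.PneNP.Theorems.PstarCubeIdeals (IsAffineFn)
open Summit.PneNP.PneNP.Theorems.PstarQuadRank (rad)
open Summit.PneNP.PneNP.Theorems.PstarProductRank (qform polar)
open Summit.PneNP.PneNP.Theorems.PstarReadSumset (V2)
open Summit.PneNP.PneNP.Theorems.PstarChordSystem (ChordSystem)
open Summit.PneNP.PneNP.Theorems.PstarChordBridgeTools (privs coef)
open Summit.PneNP.PneNP.Theorems.PstarChordBridge (BridgeData sys sys_F sys_t Solution Lift)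
open Summit.PneNP.PneNP.Theorems.PstarChordBridgeForcing (gam freeMon sys_u_eq)
open Summit.PneNP.PneNP.Theorems.PstarChordBridgeBasis (qDir polarDir)
open Summit.PneNP.PneNP.Theorems.PstarChordBridgeCorner (qDir_add)
open Summit.PneNP.PneNP.Theorems.PstarGateBridge (GateHyp const_of_others gate_reads caseP_forced caseP_fst)
open Summit.PneNP.PneNP.Theorems.PstarGateNodes (GateData ReadAlong AllRead)
open Summit.PneNP.PneNP.Theorems.PstarGateNodesX (GateDataX)
open Summit.PneNP.PneNP.Theorems.PstarGateBudget (gate_budget)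
open Summit.PneNP.PneNP.Theorems.PstarGateBudgetCrosses (gate_budget_crosses)
open Summit.PneNP.PneNP.Theorems.PstarGateCasePUnitsTouch (touch_of_gateHyp not_mem_C_of_qDir freeMon_avoid_of_polarDir_zero)
open Summit.PneNP.PneNP.Theorems.PstarGateCasePUnitsLocal (qDir_shift_invariant gfun_shift_invariant reads_of_shift_invariant)

namespace Summit.PneNP.PneNP.Theorems.PstarGateCasePUnitsCommon

variable {n m : ℕ}

/-! ## One other chord -/

/-- `N − e = {e'}` with `e ∈ N`: `N = {e, e'}`, `e' ≠ e`, `e' ∈ N`, `#N = 2`. -/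
theorem N_eq_pair {B : BridgeData n m} {e e' : Fin m} (he : e ∈ B.N) (hNe : B.N.erase e = {e'}) :
    B.N = {e, e'} ∧ e' ≠ e ∧ e' ∈ B.N ∧ B.N.card = 2 := by
  have he' : e' ∈ B.N.erase e := by rw [hNe]; exact mem_singleton_self _
  obtain ⟨hne, he'N⟩ := mem_erase.1 he'
  have hN : B.N = {e, e'} := by
    rw [← insert_erase he, hNe]
  refine ⟨hN, hne, he'N, ?_⟩
  rw [hN, card_pair hne.symm]

/-! ## The gate coefficient -/

/-- `ℓ = κ₀ + x_u` is affine. -/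
theorem coef_add {ℓ : (Fin n → ZMod 2) → ZMod 2} {κ₀ : ZMod 2} {u : Fin n} (hcoef : ∀ x, ℓ x = κ₀ + x u) : IsAffineFn ℓ := by
  intro x w
  rw [hcoef, hcoef, hcoef, hcoef, Pi.add_apply, Pi.zero_apply]
  have e3 : ∀ a b k : ZMod 2, k + (a + b) = k + a + (k + b) + (k + 0) := by decide
  exact e3 _ _ _

/-- `ℓ` is invariant under the flip of any coordinate other than `u`. -/
theorem coef_shift {ℓ : (Fin n → ZMod 2) → ZMod 2} {κ₀ : ZMod 2} {u : Fin n} (hcoef : ∀ x, ℓ x = κ₀ + x u) {v : Fin n} (hvu : v ≠ u)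
    (x : Fin n → ZMod 2) : ℓ (x + Pi.single v (1 : ZMod 2)) = ℓ x := by
  rw [hcoef, hcoef, Pi.add_apply, Pi.single_eq_of_ne (Ne.symm hvu), add_zero]

/-- The shifted first form `q̃ = q_{(0,1)} + ℓ + c` has polar form `polarDir (0,1)`. -/
theorem qt_add (I : LocalMap 4 n m) (B : BridgeData n m) {ℓ : (Fin n → ZMod 2) → ZMod 2} (hℓ : IsAffineFn ℓ) (c : ZMod 2) :
    ∀ x w, (qDir I B (0, 1) (x + w) + ℓ (x + w) + c) =
      (qDir I B (0, 1) x + ℓ x + c) + (qDir I B (0, 1) w + ℓ w + c) + (qDir I B (0, 1) 0 + ℓ 0 + c) + polarDir I B (0, 1) x w := by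
  intro x w
  rw [qDir_add, hℓ x w]
  generalize qDir I B (0, 1) x = a; generalize qDir I B (0, 1) w = a'; generalize qDir I B (0, 1) 0 = a₀
  generalize ℓ x = b; generalize ℓ w = b'; generalize ℓ 0 = b₀; generalize polarDir I B (0, 1) x w = d; generalize c = k
  revert a a' a₀ b b' b₀ d k; decide

/-! ## (T3) pins the first form on `Z(q)` -/

/-- **(P3)**: with one other chord, CASE P, `Z(q_{(1,0)}) ⊆ {q_{(0,1)} + ℓ + σ₀ + 1 = 0}`, where `σ₀` is the (constant) read of `e'`. -/
theorem caseP_P3 (I : LocalMap 4 n m) (hI : I.IsPure xorAndPred) (hT : Typed I) {B : BridgeData n m} (hW : B.WF I) (hL : Lift I B)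
    {e e' : Fin m} (hG : GateHyp I B e) (hN : B.N = {e, e'}) (hne : e' ≠ e) (hT3 : ¬ ∃ z, Solution I B B.J₀ z)
    (hRA : ReadAlong I B e (1, 0)) (hread : AllRead I B e) :
    ∀ x, qDir I B (1, 0) x = 0 →
      qDir I B (0, 1) x + coef I B.C₁ B.G₁ (I.vars e 2) x + ((((sys I B).ρ e' 0 + (sys I B).ρ' e' 0).1) + 1) = 0 := by
  classical
  intro x hx
  have he'N : e' ∈ B.N := by rw [hN]; exact mem_insert_of_mem (mem_singleton_self _)
  have hfst := caseP_fst I hI hT hW hL hG hT3 hRA hx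
  obtain ⟨hON, hgate⟩ := caseP_forced I hI hT hW hL hG hT3 hRA hread hx
  -- `e'` is ON
  have hu' : (sys I B).u e' x ≠ 0 := by
    rw [sys_u_eq, hON e' he'N hne]; generalize gam B e' = t; revert t; decide
  -- the filtered sum over `N = {e, e'}`
  rw [sum_filter, hN, sum_pair hne.symm, if_pos hu'] at hfst
  obtain ⟨hρ, hρ'⟩ := gate_reads I hI hG x
  have hconst := const_of_others I hW hG e' he'N hne x 0
  rw [hρ, hρ', hconst.1, hconst.2, add_zero] at hfst
  -- `q_{(0,1)} = F₁ + t₁`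
  have hq01 : qDir I B (0, 1) x = ((sys I B).F x).1 + (sys I B).t.1 := by
    unfold PstarChordBridgeBasis.qDir; rw [sys_F, sys_t]; simp
  rw [hq01]
  -- the gated chord contributes exactly `ℓ x`
  by_cases hc : coef I B.C₁ B.G₁ (I.vars e 2) x = 0
  · rw [hc] at hfst ⊢
    have h0 : (if ¬ (sys I B).u e x = 0 then ((0 : ZMod 2), (0 : ZMod 2)).1 else 0) = 0 := by split_ifs <;> rfl
    rw [h0, zero_add] at hfst
    revert hfst
    generalize ((sys I B).F x).1 = f; generalize (sys I B).t.1 = t; generalize ((sys I B).ρ e' 0 + (sys I B).ρ' e' 0).1 = s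
    revert f t s; decide
  · have hue : (sys I B).u e x ≠ 0 := by
      rw [sys_u_eq, hgate hc]; generalize gam B e = t; revert t; decide
    rw [if_pos hue] at hfst
    have hc1 : coef I B.C₁ B.G₁ (I.vars e 2) x = 1 := by
      rcases (by decide : ∀ t : ZMod 2, t = 0 ∨ t = 1) (coef I B.C₁ B.G₁ (I.vars e 2) x) with h | h
      · exact absurd h hc
      · exact h
    rw [hc1] at hfst ⊢
    revert hfst
    generalize ((sys I B).F x).1 = f; generalize (sys I B).t.1 = t; generalize ((sys I B).ρ e' 0 + (sys I B).ρ' e' 0).1 = s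
    revert f t s; decide

/-! ## Private tree edges far from the forcing family do not exist -/

/-- **Far-private kill.**  One-gate data, the rank of `q = q_{(1,0)}` at least four, (P3) for an affine `ℓ` invariant off `u`; a tree edge `π`
private within `J₀ ∪ {g₀}` whose two AND variables `v` avoid a non-empty family `D'` with `Z(q) ⊆ {Q_{D'} = c}` and satisfy
`polarDir (1,0) (·, e_v) = 0`: contradiction. -/
theorem false_of_private_far (I : LocalMap 4 n m) (hI : I.IsPure xorAndPred) (hT : Typed I) (hS : SimpleOverlap I) {B : BridgeData n m}
    (hW : B.WF I) (hd₁ : Disjoint B.G₁ B.J₀) (hd₂ : Disjoint B.G₂ B.J₀) {e g₀ : Fin m} {u : Fin n} (hG : GateHyp I B e) (hg₀ : g₀ ∈ B.G₁)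
    (hgu : u ∈ varSet I g₀) (hG₁p : ∀ g ∈ B.G₁.erase g₀, I.vars g 2 ≠ I.vars e 2 ∧ I.vars g 3 ≠ I.vars e 2)
    (hT3 : ¬ ∃ z, Solution I B B.J₀ z) (hM0 : ∀ f ∈ B.J₀, ∃ z, Solution I B (B.J₀.erase f) z)
    (hrank : finrank (ZMod 2) (rad (polarDir I B (1, 0))) + 4 ≤ finrank (ZMod 2) (Fin n → ZMod 2))
    {ℓ : (Fin n → ZMod 2) → ZMod 2} {κ₀ : ZMod 2} (hcoef : ∀ x, ℓ x = κ₀ + x u)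
    {c₁ : ZMod 2} (hP3 : ∀ x, qDir I B (1, 0) x = 0 → qDir I B (0, 1) x + ℓ x + c₁ = 0)
    {D' : Finset (Fin m)} {c : ZMod 2} (hD' : D'.Nonempty)
    (hP1 : ∀ x, qDir I B (1, 0) x = 0 → qform D' (fun j => I.vars j 2) (fun j => I.vars j 3) x = c)
    {π : Fin m} (hπ : π ∈ B.J₀ \ B.N) (hpriv : ∀ j ∈ insert g₀ B.J₀, j ≠ π → I.vars π 2 ∉ varSet I j ∧ I.vars π 3 ∉ varSet I j)
    (hfar : ∀ s : Fin 4, 2 ≤ s.val → (∀ j ∈ D', I.vars j 2 ≠ I.vars π s ∧ I.vars j 3 ≠ I.vars π s) ∧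
      ∀ w, polarDir I B (1, 0) (Pi.single w 1) (Pi.single (I.vars π s) 1) = 0) : False := by
  classical
  have hπJ : π ∈ B.J₀ := (mem_sdiff.1 hπ).1
  have hg₀J : g₀ ∉ B.J₀ := fun h => Finset.disjoint_left.1 hd₁ hg₀ h
  have hg₀π : g₀ ≠ π := fun h => hg₀J (h ▸ hπJ)
  -- the two AND variables are not `u`, and both constraint forms are invariant under their flips
  have key : ∀ s : Fin 4, 2 ≤ s.val →
      I.vars π s ∉ B.C₁ ∧ I.vars π s ∉ B.C₂ ∧
      (∀ g ∈ freeMon I B.N B.G₁, I.vars g 2 ≠ I.vars π s ∧ I.vars g 3 ≠ I.vars π s) ∧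
      (∀ g ∈ freeMon I B.N B.G₂, I.vars g 2 ≠ I.vars π s ∧ I.vars g 3 ≠ I.vars π s) := by
    intro s hs
    set v := I.vars π s with hv
    have hvg₀ : v ∉ varSet I g₀ := by
      obtain ⟨h2, h3⟩ := hpriv g₀ (mem_insert_self _ _) hg₀π
      have : s = 2 ∨ s = 3 := by
        rcases s with ⟨s, hs4⟩
        simp only [Fin.ext_iff] at *
        omega
      rcases this with rfl | rfl
      · exact h2
      · exact h3
    have hvu : v ≠ u := fun h => hvg₀ (h ▸ hgu)
    obtain ⟨hfarv, hpolv⟩ := hfar s hs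
    have hqv := qDir_shift_invariant I hI hS B (1, 0) hP1 hpolv hfarv hD'
    have hgv := gfun_shift_invariant I B (coef_add hcoef) hrank hP3 hqv (coef_shift hcoef hvu)
    obtain ⟨hq0, hqpol⟩ := reads_of_shift_invariant I B (1, 0) hqv
    obtain ⟨hg0, hgpol⟩ := reads_of_shift_invariant I B (0, 1) hgv
    obtain ⟨hC₁, -⟩ := not_mem_C_of_qDir I hI hT hW hπ hs
    obtain ⟨-, hC₂⟩ := not_mem_C_of_qDir I hI hT hW hπ hs
    obtain ⟨hf₁, -⟩ := freeMon_avoid_of_polarDir_zero I hI hS hW hd₁ hd₂ (v := v)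
    obtain ⟨-, hf₂⟩ := freeMon_avoid_of_polarDir_zero I hI hS hW hd₁ hd₂ (v := v)
    exact ⟨hC₁ hg0, hC₂ hq0, hf₁ hgpol, hf₂ hqpol⟩
  obtain ⟨h2C₁, h2C₂, h2f₁, h2f₂⟩ := key 2 (by decide)
  obtain ⟨h3C₁, h3C₂, h3f₁, h3f₂⟩ := key 3 (by decide)
  exact touch_of_gateHyp I hI hG hg₀J hG₁p hT3 hπJ (hM0 π hπJ) hpriv ⟨h2C₁, h3C₁, h2C₂, h3C₂⟩
    (fun g hg => ⟨(h2f₁ g hg).1, (h2f₁ g hg).2, (h3f₁ g hg).1, (h3f₁ g hg).2⟩)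
    (fun g hg => ⟨(h2f₂ g hg).1, (h2f₂ g hg).2, (h3f₂ g hg).1, (h3f₂ g hg).2⟩)

/-- **No private edge in a CONS-T pair with a counted gadget.**  If `g` (in the counted family `X`) holds `σ ∈ andPair j₁` and `τ ∈ andPair j₂`
(disjoint AND pairs), then neither `j₁` nor `j₂` is private within `X`. -/
theorem false_of_private_pair (I : LocalMap 4 n m) {X : Finset (Fin m)} {j₁ j₂ g π : Fin m} {σ τ : Fin n}
    (hdisj : Disjoint (andPair I j₁) (andPair I j₂)) (hσ : σ ∈ andPair I j₁) (hτ : τ ∈ andPair I j₂) (hgX : g ∈ X)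
    (hσg : σ ∈ andPair I g) (hτg : τ ∈ andPair I g) (hπ : π = j₁ ∨ π = j₂)
    (hpriv : ∀ j ∈ X, j ≠ π → I.vars π 2 ∉ varSet I j ∧ I.vars π 3 ∉ varSet I j) : False := by
  have hg₁ : g ≠ j₁ := fun h => Finset.disjoint_left.1 hdisj (h ▸ hτg) hτ
  have hg₂ : g ≠ j₂ := fun h => Finset.disjoint_left.1 hdisj hσ (h ▸ hσg)
  rcases hπ with rfl | rfl
  · obtain ⟨h2, h3⟩ := hpriv g hgX hg₁
    rcases (mem_andPair_iff I π σ).1 hσ with h | h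
    · exact h2 (h ▸ andPair_subset_varSet I g hσg)
    · exact h3 (h ▸ andPair_subset_varSet I g hσg)
  · obtain ⟨h2, h3⟩ := hpriv g hgX hg₂
    rcases (mem_andPair_iff I π τ).1 hτ with h | h
    · exact h2 (h ▸ andPair_subset_varSet I g hτg)
    · exact h3 (h ▸ andPair_subset_varSet I g hτg)

/-! ## The two budgets -/

/-- **No private tree edge ⟹ `#J₀ ≤ 3`** (the one-gate budget with `#N = 2`). -/
theorem card_le_three_of_no_private (I : LocalMap 4 n m) {r : ℕ} (hB : BoundaryExpanding r I) {B : BridgeData n m} {e g₀ : Fin m}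
    {u : Fin n} {κ₀ : ZMod 2} (hD : GateDataX I r B e g₀ u κ₀) (hN2 : B.N.card = 2)
    (h : ∀ π ∈ B.J₀ \ B.N, (∀ j ∈ insert g₀ B.J₀, j ≠ π → I.vars π 2 ∉ varSet I j ∧ I.vars π 3 ∉ varSet I j) → False) :
    B.J₀.card ≤ 3 := by
  obtain ⟨Pv, hPv, hpriv, hcount⟩ := gate_budget I hB hD
  have hW : B.WF I := hD.2.1
  have hPv0 : Pv = ∅ := eq_empty_of_forall_notMem fun π hπ => h π (hPv hπ) (hpriv π hπ)
  rw [hPv0, card_empty, mul_zero, add_zero, hN2] at hcount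
  have hJ : B.J₀.card = B.N.card + (B.J₀ \ B.N).card := by
    rw [← card_union_of_disjoint disjoint_sdiff, union_sdiff_of_subset hW.hN]
  omega

/-- **No private tree edge with one cross gate counted ⟹ `#J₀ ≤ 4`.** -/
theorem card_le_four_of_cross (I : LocalMap 4 n m) {r : ℕ} (hB : BoundaryExpanding r I) {B : BridgeData n m} {e g₀ : Fin m}
    {u : Fin n} {κ₀ : ZMod 2} (hD : GateDataX I r B e g₀ u κ₀) (hN2 : B.N.card = 2) {g : Fin m} (hg : g ∈ B.G₁ ∪ B.G₂) (hgJ : g ∉ B.J₀)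
    (hgg : g ≠ g₀) (hold : (∃ j ∈ B.J₀, I.vars g 2 ∈ varSet I j) ∧ (∃ j ∈ B.J₀, I.vars g 3 ∈ varSet I j))
    (h : ∀ π ∈ B.J₀ \ B.N, (∀ j ∈ insert g (insert g₀ B.J₀), j ≠ π → I.vars π 2 ∉ varSet I j ∧ I.vars π 3 ∉ varSet I j) → False) :
    B.J₀.card ≤ 4 := by
  classical
  have hO : ({g} : Finset (Fin m)) ⊆ B.G₁ ∪ B.G₂ := singleton_subset_iff.2 hg
  have hOJ : Disjoint ({g} : Finset (Fin m)) B.J₀ := disjoint_singleton_left.2 hgJ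
  have hOg : g₀ ∉ ({g} : Finset (Fin m)) := fun h' => hgg (mem_singleton.1 h').symm
  obtain ⟨Pv, hPv, hpriv, hcount⟩ := gate_budget_crosses I hB hD hO hOJ hOg (fun o ho => by rw [mem_singleton.1 ho]; exact hold)
  have hW : B.WF I := hD.2.1
  have hPv0 : Pv = ∅ := eq_empty_of_forall_notMem fun π hπ => h π (hPv hπ) (fun j hj => hpriv π hπ j (by
    rw [mem_insert] at hj
    rcases hj with rfl | hj
    · exact mem_union_left _ (mem_singleton_self _)
    · exact mem_union_right _ hj))
  rw [hPv0, card_empty, mul_zero, add_zero, hN2, card_singleton] at hcount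
  have hJ : B.J₀.card = B.N.card + (B.J₀ \ B.N).card := by
    rw [← card_union_of_disjoint disjoint_sdiff, union_sdiff_of_subset hW.hN]
  omega

end Summit.PneNP.PneNP.Theorems.PstarGateCasePUnitsCommon
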